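import Summits.BirchSwinnertonDyer.BirchSwinnertonDyer.Theorems.AdditiveBranchIMCGordTwoTwistedReciprocity
import HarnessLib

/-!
# The twisted Wan road (crux 19357, line `three_field_road`, design D2 of FieldTwoTwisted): THE RECIPROCITY IDENTITY, KRONECKER FORM
# (LEAD g17, brick «λ₂-flip»)

Theorems only, pure arithmetic. The sibling of `prod_engine_eq_jacobiSym` (p799849) for the KRONECKER form of the root-number engine
(`TwistRootNumberTwisted.rootNumber_quadraticTwist_eq_of_potMult_kronecker`): the engine's factor at a multiplicative `2` is `χ₈(D′)`
(the Kronecker symbol `(D′/2)`) instead of the junk `jacobiSym D′ 2 = 1`, and the identity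

  `∏_{r ∈ N.primeFactors ∖ {q}} [f_r = 1] k_r(D′) = (N/p)`,  `k_2 = χ₈`, `k_r = (D′/r)` at odd `r`,

holds when every exponent of `N` is `1` or `2`, `f_q ≠ 1`, `p ∤ N` odd, `(D′/r) = (p*/r)` at the odd `r ∥ N` other than `q`, and — the
new clause replacing design D2's `(2/p) = 1` — `χ₈(D′) = (2/p)` when `2 ∥ N` (in design D2: `D′ ≡ ℓ₀* ≡ p* (mod 8)`, and
`χ₈(p*) = χ₈(p) = (2/p)`). So NO condition on `p` modulo `8` remains.

* `prod_engineKronecker_eq_jacobiSym` — the displayed identity;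
* `χ₈_intCast_eq_jacobiSym_two_of_emod_eight` — `χ₈(D′) = (2/p)` when `D′ ≡ p* (mod 8)`, `p` odd.

References: [IrelandRosen1990] Ch. 5 §2 (quadratic reciprocity, the Jacobi symbol, `(2/p)`).
-/

set_option linter.dupNamespace false
set_option autoImplicit false

open scoped Classical

namespace Summit.BirchSwinnertonDyer.BirchSwinnertonDyer.Theorems.TwistedWanRoad

open NumberTheorySymbols

/-- `χ₈` only depends on the residue modulo `8`: for integers `a ≡ b (mod 8)`, `χ₈(a) = χ₈(b)`. [folklore] -/
theorem χ₈_intCast_congr {a b : ℤ} (h : a % 8 = b % 8) : ZMod.χ₈ (a : ZMod 8) = ZMod.χ₈ (b : ZMod 8) := by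
  have hab : (a : ZMod 8) = (b : ZMod 8) := (ZMod.intCast_eq_intCast_iff' a b 8).mpr (by exact_mod_cast h)
  rw [hab]

/-- **`χ₈(D′) = (2/p)`** for an odd prime `p` and `D′ ≡ p* (mod 8)`: `χ₈(p*) = χ₈(±p) = χ₈(p)` (`χ₈` is even) and `(2/p) = χ₈(p)`
(`jacobiSym.at_two`). [cite: IrelandRosen1990, Ch. 5 §2 Prop. 5.1.3] -/
theorem χ₈_intCast_eq_jacobiSym_two_of_emod_eight {p : ℕ} (hp : p.Prime) (hp2 : p ≠ 2) {D : ℤ}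
    (hD : D % 8 = (((-1 : ℤ) ^ (p / 2) * p) % 8)) : ZMod.χ₈ (D : ZMod 8) = J(2 | p) := by
  have hpodd : p % 2 = 1 := hp.eq_two_or_odd.resolve_left hp2
  rw [χ₈_intCast_congr hD, jacobiSym.at_two (Nat.odd_iff.mpr hpodd), ZMod.χ₈_int_eq_if_mod_eight, ZMod.χ₈_nat_eq_if_mod_eight]
  rcases neg_one_pow_eq_or ℤ (p / 2) with h | h <;> simp only [h, one_mul, neg_one_mul] <;> split_ifs <;> omega

/-- **The reciprocity identity of design D2, Kronecker form** (module docstring): for `p ∤ N` an odd prime, all exponents of `N` in `{1, 2}`,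
`f_q ≠ 1`, `(D/r) = (p*/r)` at the odd `r ∥ N` other than `q`, and `χ₈(D) = (2/p)` if `2 ∥ N`:
`∏_{r ∈ N.primeFactors ∖ {q}} [f_r = 1] k_r(D) = (N/p)` with `k_2 = χ₈(D)`, `k_r = (D/r)` for odd `r`. [cite: IrelandRosen1990, Ch. 5 §2] -/
theorem prod_engineKronecker_eq_jacobiSym {N p q : ℕ} {D : ℤ} (hp : p.Prime) (hp2 : p ≠ 2) (hN0 : N ≠ 0) (hpN : ¬ p ∣ N)
    (hf : ∀ r ∈ N.primeFactors, N.factorization r = 1 ∨ N.factorization r = 2)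
    (hq : N.factorization q ≠ 1)
    (hD : ∀ r ∈ N.primeFactors, r ≠ 2 → r ≠ q → N.factorization r = 1 →
      J(D | r) = J(((-1 : ℤ) ^ (p / 2) * p) | r))
    (hD2 : 2 ∈ N.primeFactors → N.factorization 2 = 1 → ZMod.χ₈ (D : ZMod 8) = J(2 | p)) :
    (∏ r ∈ N.primeFactors.erase q,
        (if N.factorization r = 1 then (if r = 2 then ZMod.χ₈ (D : ZMod 8) else J(D | r)) else 1)) = J((N : ℤ) | p) := by
  rw [jacobiSym_natCast_eq_prod_primeFactors hp hN0 hpN hf,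
    ← Finset.prod_erase N.primeFactors (f := fun r ↦ if N.factorization r = 1 then J((r : ℤ) | p) else 1)
      (a := q) (by simp only [hq, if_false])]
  refine Finset.prod_congr rfl (fun r hr ↦ ?_)
  obtain ⟨hrq, hrN⟩ := Finset.mem_erase.mp hr
  by_cases h1 : N.factorization r = 1
  · simp only [h1, if_true]
    by_cases hr2 : r = 2
    · subst hr2
      rw [if_pos rfl, hD2 hrN h1, Nat.cast_ofNat]
    · rw [if_neg hr2, hD r hrN hr2 hrq h1, jacobiSym_pStar_eq_swap hp (Nat.prime_of_mem_primeFactors hrN) hp2 hr2]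
  · simp only [h1, if_false]

end Summit.BirchSwinnertonDyer.BirchSwinnertonDyer.Theorems.TwistedWanRoad
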